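import Mathlib
import Literature.AlgebraicGeometry.Resolution.PointBlowupFlagInvariant
import Literature.AlgebraicGeometry.Resolution.PointBlowupFlagMaximalShift
import Summits.ResolutionOfSingularities.ResolutionOfSingularities.Theorems.WeightedInvariantLocalWeightedDropWildPurePowerFlagDefs
import Summits.ResolutionOfSingularities.ResolutionOfSingularities.Theorems.WeightedInvariantLocalWeightedDropWildMonicShift
import Summits.ResolutionOfSingularities.ResolutionOfSingularities.Theorems.WeightedInvariantLocalWeightedDropWildMonicShiftCoeff
import Summits.ResolutionOfSingularities.ResolutionOfSingularities.Theorems.WeightedInvariantLocalWeightedDropWildMonicWCleanProcess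
import Summits.ResolutionOfSingularities.ResolutionOfSingularities.Theorems.WeightedInvariantLocalWeightedDropWildMonicFlagTripleDefs

/-!
# `WeightedInvariant.LocalWeightedDrop`, line `hasse-ridge-face-selection`, S3ρ sub-stub S3ρD `stub_wildMonicSurfaceDescent`: item D-0
# «maximising flag» — the flag family is CLOSED UNDER COMPOSITION (re-centrings commute with plane changes; D-0a basic laws)

Crux item stmt-ResolutionOfSingularities-8899 `LocalWeightedDrop` (route `ResolutionOfSingularities/WeightedInvariant`), engine of the door
`HypersurfaceCentreConstruction` stmt-ResolutionOfSingularities-19897.  [OURS · L1 W4.3, chain w43, res-L1-w43-stub-3 (gen 3) on roadmap item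
D-0 of `L/res-L1-w43-stub-7/S3RHOD-ROADMAP.md` under the S3ρ owners res-type-083 / stub-7; spec `L/res-L1-w43-stub-3/D0-SPEC.md`.  MODEL: Perlega,
arXiv:2011.14443 §5.3 (simultaneous changes `z ↦ z + g(x,y)`, `y ↦ y + h(x)`; the chain of pairs `(g_i, h_i)` of Prop. 5.3.5 is composed
and differenced inside the family, Lemma 5.3.1 `double_coord_change`).  Folklore algebra on res-type-083's `WildMonic.shift` (the Taylor
shift of the monic form, `…WildMonicShift`) and stub-1's plane shear `PurePowerFlag.shift`; NOT a statement of any manuscript.]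

* `map_monicPoly` / `map_shift` — a ring homomorphism `f` carries the re-centred tuple to the re-centred image tuple:
  `f (shift d A g j) = shift d (f ∘ A) (f g) j` (`Polynomial.map_comp` on `taylor g = comp (X + C g)`); `subst_shift` — the case
  `f = subst θ` of a plane change: PLANE CHANGES COMMUTE WITH RE-CENTRINGS up to transporting `g`;
* `flagTuple_zero_zero` — the trivial flag gives the tuple back; **`flagTuple_flagTuple`** — COMPOSITION LAW of the family of
  `…WildMonicFlagTripleDefs`: `flagTuple d (flagTuple d A g h) g′ h′ = flagTuple d A (θ_{h′}^* g + g′) (h + h′)` (stub-6/res-lit-5's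
  `subst_shift_subst_shift` for the plane shears + `WildMonic.shift_shift`), so differences of flags are flags (Prop. 5.3.5's Cauchy chain).
-/

set_option linter.dupNamespace false -- mandated namespace of this single-conjunct summit

namespace Summit.ResolutionOfSingularities.ResolutionOfSingularities.Theorems

namespace WildMonic

open MvPowerSeries
open Literature.AlgebraicGeometry.Resolution

/-! ### Ring homomorphisms and the Taylor shift of a tuple -/

section Map

variable {R S : Type*} [CommRing R] [CommRing S] {d : ℕ}

/-- The monic form's polynomial is natural: `(monicPoly d A).map f = monicPoly d (f ∘ A)`. -/
theorem map_monicPoly (f : R →+* S) (A : Fin d → R) : (monicPoly d A).map f = monicPoly d (fun j => f (A j)) := by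
  rw [monicPoly, monicPoly, Polynomial.map_add, Polynomial.map_pow, Polynomial.map_X, Polynomial.map_sum]
  congr 1
  refine Finset.sum_congr rfl fun j _ => ?_
  rw [Polynomial.map_mul, Polynomial.map_C, Polynomial.map_pow, Polynomial.map_X]

/-- **RE-CENTRINGS ARE NATURAL**: a ring homomorphism carries the shifted tuple to the shifted image tuple,
`f (shift d A g j) = shift d (f ∘ A) (f g) j`. -/
theorem map_shift (f : R →+* S) (A : Fin d → R) (g : R) (j : Fin d) :
    f (shift d A g j) = shift d (fun i => f (A i)) (f g) j := by
  rw [shift, shift, ← Polynomial.coeff_map, Polynomial.taylor_apply, Polynomial.map_comp, map_monicPoly, Polynomial.map_add,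
    Polynomial.map_X, Polynomial.map_C, ← Polynomial.taylor_apply]

end Map

variable {k : Type} [Field k] {d : ℕ}

/-- **PLANE CHANGES COMMUTE WITH RE-CENTRINGS**: `θ^*(shift d A g) = shift d (θ^* A) (θ^* g)` for every substitution `θ` of the plane
letters. [cite: Perlega2020, Lemma 5.3.1 (arXiv:2011.14443 chunk p0063 «double_coord_change»)] -/
theorem subst_shift {σ : Type*} {θ : Fin 2 → MvPowerSeries σ k} (hθ : HasSubst θ) (A : Fin d → MvPowerSeries (Fin 2) k)
    (g : MvPowerSeries (Fin 2) k) (j : Fin d) :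
    subst θ (shift d A g j) = shift d (fun i => subst θ (A i)) (subst θ g) j := by
  have h := map_shift (substAlgHom hθ).toRingHom A g j
  simpa only [AlgHom.toRingHom_eq_coe, RingHom.coe_coe, coe_substAlgHom] using h

/-! ### The family of flags is closed under composition -/

/-- The trivial flag: no re-centring, no shear — the tuple itself. -/
theorem flagTuple_zero_zero (A : Fin d → MvPowerSeries (Fin 2) k) : flagTuple d A 0 0 = A := by
  rw [flagTuple_def, shift_zero]
  funext j
  exact HauserPerlega2024.subst_shift_zero (0 : Fin 2) 1 (A j)

/-- Shearing the re-centred tuple: `θ_{h}^*(flagTuple d A g 0) … ` — the plane shear of a flag tuple is the flag tuple of the transported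
re-centring (no shear in the first flag). -/
theorem subst_shift_flagTuple (A : Fin d → MvPowerSeries (Fin 2) k) (g : MvPowerSeries (Fin 2) k) {h h' : PowerSeries k}
    (hh : PowerSeries.constantCoeff h = 0) (hh' : PowerSeries.constantCoeff h' = 0) (j : Fin d) :
    subst (PurePowerFlag.shift h') (flagTuple d A g h j) =
      shift d (fun i => subst (PurePowerFlag.shift (h + h')) (A i)) (subst (PurePowerFlag.shift h') g) j := by
  have hθ : HasSubst (PurePowerFlag.shift h') := HauserPerlega2024.hasSubst_shift (0 : Fin 2) 1 h' hh'
  rw [flagTuple_def, subst_shift hθ]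
  congr 1
  funext i
  exact HauserPerlega2024.subst_shift_subst_shift (0 : Fin 2) 1 (by decide) h h' hh hh' (A i)

/-- **THE COMPOSITION LAW OF THE FLAG FAMILY**: a flag of a flag tuple is a flag of the tuple —
`flagTuple d (flagTuple d A g h) g′ h′ = flagTuple d A (θ_{h′}^* g + g′) (h + h′)` (`h(0) = h′(0) = 0`).  Hence the family
`{flagTuple d A g h}` of `…WildMonicFlagTripleDefs` is closed under composition, and two flags differ by a flag (the Cauchy chain of
Perlega's Prop. 5.3.5 lives inside the family). [cite: Perlega2020, §5.3 Prop. 5.3.5 proof (arXiv:2011.14443 chunk p0066 «G_i = g_{i+1} − g_i, H_i = h_{i+1} − h_i»)] -/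
theorem flagTuple_flagTuple (A : Fin d → MvPowerSeries (Fin 2) k) (g g' : MvPowerSeries (Fin 2) k) {h h' : PowerSeries k}
    (hh : PowerSeries.constantCoeff h = 0) (hh' : PowerSeries.constantCoeff h' = 0) :
    flagTuple d (flagTuple d A g h) g' h' = flagTuple d A (subst (PurePowerFlag.shift h') g + g') (h + h') := by
  have hfun : (fun j => subst (PurePowerFlag.shift h') (flagTuple d A g h j)) =
      shift d (fun i => subst (PurePowerFlag.shift (h + h')) (A i)) (subst (PurePowerFlag.shift h') g) := by
    funext j
    exact subst_shift_flagTuple A g hh hh' j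
  rw [flagTuple_def d (flagTuple d A g h) g' h', hfun, shift_shift, add_comm g', ← flagTuple_def]

/-- Re-centring only: `flagTuple d (flagTuple d A g h) g′ 0 = flagTuple d A (g + g′) h`. -/
theorem flagTuple_flagTuple_zero (A : Fin d → MvPowerSeries (Fin 2) k) (g g' : MvPowerSeries (Fin 2) k) {h : PowerSeries k}
    (hh : PowerSeries.constantCoeff h = 0) :
    flagTuple d (flagTuple d A g h) g' 0 = flagTuple d A (g + g') h := by
  rw [flagTuple_flagTuple A g g' hh (map_zero _), add_zero]
  have h0 : subst (PurePowerFlag.shift 0) g = g := HauserPerlega2024.subst_shift_zero (0 : Fin 2) 1 g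
  rw [h0]

end WildMonic

end Summit.ResolutionOfSingularities.ResolutionOfSingularities.Theorems
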